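import Mathlib
import Summits.Ventures.PercRepro2.HCov
import Summits.Ventures.PercRepro2.HCovCubic
import Summits.Ventures.PercRepro2.TriDisagreement
import Summits.Ventures.PercRepro2.TriDisagreementPinned
import Summits.Ventures.PercRepro2.TypedSplit
import Summits.Ventures.PercRepro2.OneTypedEdge
import Summits.Ventures.PercRepro2.TypedSeries

/-!
# A star end of degree two is series-reducible (blind cell PercRepro2, p1 g12; the lead's NEG-109
scope correction, 2026-08-24T16:24Z: «a star end `u` of degree 2 (pendant at `w` through a type-1
edge) obeys `N_{τ+(2,2,2)}(G″ + (w,u)¹ + y→x,z,u) = 2·N_{τ+(2,2,1)}(G″ + y→x,z,w) +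
3·N_{τ+(2,2)}(G″ + y→x,z)`»)

Rule (a) of the typed-base calculus (`typedCount_series_deg2`, night-3) at the end `u` of the
star edge `e = {y, u}` of type `2` whose other edge `f = {u, w}` has type `1`: the typed count is
`3 ·` (the count with `e` of type `0`, i.e. the star without that end) `+ 2 ·` (the count with `e`
of type `1` and `f` pinned open, i.e. the end `w` reached through `u`): **`typedCount_end_deg2`**
(`muAnd 2 1 0 = 3`, `muAnd 2 1 1 = 2`, the type-`2` / `3` terms vanish). So at such a star the
`(2,2,2)` hard step is a non-negative combination of a `(2,2,1)` step and a degree-two star — the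
NEG-109 witness class is series-reducible (two-largest holds there by induction; the one-leaf
`Pay222` fails because the payment splits between the two leaves through `u`). Identity only.
-/

namespace Summit.Ventures.PercRepro2

open CovForm CovForm.OneTyped CovForm.TypedRed

namespace StarPattern

section EndSeries

variable {V : Type*} {E : Type*} [Fintype E] [DecidableEq E] {R : Type*} [Field R]

/-- **A degree-two end of a type-`2` star edge**: `N = 3 · N(e closed) + 2 · N(e of type 1, f open)`. -/
theorem typedCount_end_deg2 (ends : E → Sym2 V) (o a₁ a₂ a₃ b : V) {e f : E} (hef : e ≠ f)
    {y u w : V} (he : ends e = s(y, u)) (hf : ends f = s(u, w)) (huy : u ≠ y) (huw : u ≠ w)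
    (hdeg : ∀ e', u ∈ ends e' → e' = e ∨ e' = f) (huo : u ≠ o) (hu1 : u ≠ a₁) (hu2 : u ≠ a₂)
    (hu3 : u ≠ a₃) (hub : u ≠ b) (F : Finset E) (heF : e ∈ F) (hfF : f ∈ F) (z : Config E)
    (τ : E → ℕ) (hτe : τ e = 2) (hτf : τ f = 1) :
    typedCount F z τ (K3 ends o a₁ a₂ a₃ b : Config E → Config E → Config E → R) =
      3 * typedCount (F.erase f) (Function.update z f true) (Function.update τ e 0)
          (K3 ends o a₁ a₂ a₃ b) +
        2 * typedCount (F.erase f) (Function.update z f true) (Function.update τ e 1)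
          (K3 ends o a₁ a₂ a₃ b) := by
  rw [typedCount_series_deg2 ends o a₁ a₂ a₃ b hef he hf huy huw hdeg huo hu1 hu2 hu3 hub F heF
    hfF z τ (Or.inr hτe) (Or.inl hτf)]
  simp only [Finset.sum_range_succ, Finset.sum_range_zero, hτe, hτf, muAnd, Nat.cast_ofNat,
    Nat.cast_zero, zero_add, zero_mul, add_zero]

end EndSeries

end StarPattern

end Summit.Ventures.PercRepro2
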